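import Summits.RiemannHypothesis.RiemannHypothesis.Theorems.LaguerreSignBelowVerifiedHeight
import Summits.RiemannHypothesis.RiemannHypothesis.Theorems.LaguerreSpeiserSplitXiPrimeOnLineJensenNesting
import Literature.NumberTheory.LFunctions.XiHigherDerivativesCriticalStrip
import HarnessLib

/-!
# The zeros of `Ξ′` below the verified height are real (far rung of `XiPrimeOnLine`, RH-free given Platt–Trudgian)

Route `LaguerreSpeiserSplit`, support item `XiPrimeRealBelowVerifiedHeight`
(stmt-RiemannHypothesis-23771): the far twin of the rung `laguerreSignBelowVerifiedHeight`
(stmt-RiemannHypothesis-23624).  CONDITIONAL on the named numerical fact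
`Literature.NumberTheory.DiophantineGeometry.riemannHypothesisUpTo_platt_trudgian` (RH verified for
`0 < Im s ≤ 3 000 175 332 800`, Platt–Trudgian, Bull. LMS 53 (2021) Thm 1), taken as a hypothesis.
Nothing here bears on the truth of RH; RH is NOT proved by this file, and the crux `XiPrimeOnLine`
itself (all heights) stays open.

**Theorem `xiPrimeRealBelowVerifiedHeight`.**  Assume RH up to height `H = 3000175332800`.  Then
every zero `z` of `Ξ′` with `|Re z| < H − ½` is real.

**Proof (the bookkeeping kernel of the registered skeleton, on top of two landed engines).**  Suppose
`Im z ≠ 0`.  By Jensen nesting (`Theorems.XiPrimeOnLine.stub_jensenNesting`, Jensen's circle theorem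
for the real entire function `Ξ` of order `< 2`) there is a non-real zero `ρ` of `Ξ` with
`‖z − Re ρ‖ ≤ |Im ρ|`, and `|Im ρ| < ½` (`abs_im_lt_half_of_riemannXiUpper_eq_zero`).  Hence
`|Re z − Re ρ| < ½` and `|Re ρ| ≤ |Re z| + ½ ≤ H`.  Under RH up to height `H` every zero of `Ξ` with
`|Re ρ| ≤ H` is real (`LaguerreSignBelowVerifiedHeight.im_eq_zero_of_riemannXiUpper_eq_zero_of_abs_re_le`)
— contradicting `Im ρ ≠ 0`.
-/

-- `Summit.RiemannHypothesis.RiemannHypothesis.…` repeats a component by the tree's layout (D-0017).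
set_option linter.dupNamespace false

noncomputable section

namespace Summit.RiemannHypothesis.RiemannHypothesis.Theorems

open Literature.NumberTheory.LFunctions Literature.NumberTheory.DiophantineGeometry

/-- **The zeros of `Ξ′` below the verified height are real** (support item
`XiPrimeRealBelowVerifiedHeight`, stmt-RiemannHypothesis-23771, far rung of the crux `XiPrimeOnLine`;
CONDITIONAL on the named fact `riemannHypothesisUpTo_platt_trudgian` = RH verified up to height
`3 000 175 332 800`, Platt–Trudgian 2021 Thm 1).  For every `z` with `Ξ′(z) = 0` and
`|Re z| < 3000175332800 − ½`: `Im z = 0`.  (Engines: Jensen nesting `XiPrimeOnLine.stub_jensenNesting`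
— a non-real zero of `Ξ′` lies within horizontal distance `≤ |Im ρ| < ½` of a non-real zero `ρ` of
`Ξ` — and there is none with `|Re ρ| ≤ 3000175332800` under the hypothesis.)  RH is not proved by
this; nothing here bears on the truth of RH. -/
theorem xiPrimeRealBelowVerifiedHeight
    (hPT : Literature.NumberTheory.DiophantineGeometry.riemannHypothesisUpTo_platt_trudgian) :
    ∀ z : ℂ, deriv Literature.NumberTheory.LFunctions.riemannXiUpper z = 0 →
      |z.re| < 3000175332800 - 1 / 2 → z.im = 0 := by
  intro z hz hzre
  by_contra hzim
  obtain ⟨ρ, hρ, hρim, hdisc⟩ := XiPrimeOnLine.stub_jensenNesting z hz hzim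
  have hhalf : |ρ.im| < 1 / 2 := abs_im_lt_half_of_riemannXiUpper_eq_zero hρ
  have hre : |(z - (ρ.re : ℂ)).re| ≤ ‖z - (ρ.re : ℂ)‖ := Complex.abs_re_le_norm _
  have hre' : (z - (ρ.re : ℂ)).re = z.re - ρ.re := by simp
  rw [hre'] at hre
  have h1 : |z.re - ρ.re| < 1 / 2 := lt_of_le_of_lt (hre.trans hdisc) hhalf
  have h2 : |ρ.re| ≤ 3000175332800 := by
    have := abs_sub_abs_le_abs_sub ρ.re z.re
    rw [abs_sub_comm] at h1
    linarith
  exact hρim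
    (LaguerreSignBelowVerifiedHeight.im_eq_zero_of_riemannXiUpper_eq_zero_of_abs_re_le hPT hρ h2)

end Summit.RiemannHypothesis.RiemannHypothesis.Theorems

end
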